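import Literature.NumberTheory.LFunctions.WeilTwoPrimeDeflL2Base
import Literature.NumberTheory.LFunctions.WeilBlockRowsPZ
import HarnessLib

/-!
# Deflated two-prime certificate L2: the factored even inverse agrees with `D`, rows 96–103

`WeilCert.checkDnRow` (even block) for certificate L2, by `decide +kernel`. Pure proof file.
-/

noncomputable section

namespace Literature.NumberTheory.LFunctions

set_option maxHeartbeats 0 in
/-- Row 96 of `DnE/LsE` is row 96 of the even `D` (certificate L2). [folklore] -/
theorem checkDnRow0_96_weilCertDeflL2 : weilCertDeflL2Base.checkDnRow weilCertDeflL2DnE weilCertDeflL2LsE 0 96 = true := by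
  decide +kernel

set_option maxHeartbeats 0 in
/-- Row 97 of `DnE/LsE` is row 97 of the even `D` (certificate L2). [folklore] -/
theorem checkDnRow0_97_weilCertDeflL2 : weilCertDeflL2Base.checkDnRow weilCertDeflL2DnE weilCertDeflL2LsE 0 97 = true := by
  decide +kernel

set_option maxHeartbeats 0 in
/-- Row 98 of `DnE/LsE` is row 98 of the even `D` (certificate L2). [folklore] -/
theorem checkDnRow0_98_weilCertDeflL2 : weilCertDeflL2Base.checkDnRow weilCertDeflL2DnE weilCertDeflL2LsE 0 98 = true := by
  decide +kernel

set_option maxHeartbeats 0 in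
/-- Row 99 of `DnE/LsE` is row 99 of the even `D` (certificate L2). [folklore] -/
theorem checkDnRow0_99_weilCertDeflL2 : weilCertDeflL2Base.checkDnRow weilCertDeflL2DnE weilCertDeflL2LsE 0 99 = true := by
  decide +kernel

set_option maxHeartbeats 0 in
/-- Row 100 of `DnE/LsE` is row 100 of the even `D` (certificate L2). [folklore] -/
theorem checkDnRow0_100_weilCertDeflL2 : weilCertDeflL2Base.checkDnRow weilCertDeflL2DnE weilCertDeflL2LsE 0 100 = true := by
  decide +kernel

set_option maxHeartbeats 0 in
/-- Row 101 of `DnE/LsE` is row 101 of the even `D` (certificate L2). [folklore] -/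
theorem checkDnRow0_101_weilCertDeflL2 : weilCertDeflL2Base.checkDnRow weilCertDeflL2DnE weilCertDeflL2LsE 0 101 = true := by
  decide +kernel

set_option maxHeartbeats 0 in
/-- Row 102 of `DnE/LsE` is row 102 of the even `D` (certificate L2). [folklore] -/
theorem checkDnRow0_102_weilCertDeflL2 : weilCertDeflL2Base.checkDnRow weilCertDeflL2DnE weilCertDeflL2LsE 0 102 = true := by
  decide +kernel

set_option maxHeartbeats 0 in
/-- Row 103 of `DnE/LsE` is row 103 of the even `D` (certificate L2). [folklore] -/
theorem checkDnRow0_103_weilCertDeflL2 : weilCertDeflL2Base.checkDnRow weilCertDeflL2DnE weilCertDeflL2LsE 0 103 = true := by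
  decide +kernel


end Literature.NumberTheory.LFunctions
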